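import Literature.MathematicalPhysics.QuantumFieldTheory.Balaban1983to89.B8Prop6CubeMemberScalarGammaOfIneq159Printed
import Literature.MathematicalPhysics.QuantumFieldTheory.Balaban1983to89.B8Ineq159FlatCubeMemberTransplantL3
import HarnessLib

/-!
# Route `UnitScaleTilt`, crux K1 child «MinimiserStabilityRegPr» (stmt-QuantumFields-19200), registered stub `stub_halvingStep` (v10 `BirthV10`) —
# ★★ LINE «H-P6J» (★★OWNER RULING g28-№11, LEAD-H WORDS 19–21), FILE (J1): [Balaban1985RegularSpaces] PROPOSITION 6 AT THE H LANE's CUBE MEMBER, UNCONDITIONAL,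
# BY NAME FROM lit's CROWN — `GaugedBoundB8 L η U′ ⟨k, a, M′, ρ′⟩ (7dL²·(5dLB₀)·M′·α₀)` for EVERY odd `L ≥ 3`, every unitary background `U′ ∈ 𝔄_k(ℤᵈ, α₀)`

Cell `ym3-torus` (HUMAN RULING D-0037: YM₃ on T³ is ladder rung R3 — NOT d = 4, NOT a mass gap, NOT the Clay problem), width seat `ym-ust-19200-w7` gen 6 (row (J1) of line
H-P6J; LOCATE-PROP6-JUNCTION 5b0d193f, LOCATE-EDITION e942c2d4, LOCATE-3 33cc5e9c on 19200).  `--supports stmt-QuantumFields-19200 --as helper`; THEOREMS ONLY (0 `def`, 0 `sorry`);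
count-neutral; nothing here claims `hSupUρ4`, the stub, the crux or the gap.

WHAT.  pub-ymgap's N05 lineage (cell `pub-ymgap`, dag-n05-c ∕ dag-n05-w3, 2026-08-27∕28) PROVED [B8] Prop. 6 at every PURE cube member `{□_j}` of (1.131) in the scalar edition γ:
lit ✓`B8Prop6CubeMemberScalarGammaOfIneq159Printed.gaugedBoundB8_cubeMember_scalar_γ_of_ineq159Printed (hd2 : 2 ≤ d) (hL : 2 ≤ L) (hdL : 5 ≤ d·L)
(h159 : Ineq159FlatCubeMemberPrinted d L)` and lit ✓`B8Ineq159FlatCubeMemberTransplantL3.ineq159FlatCubeMemberPrinted_holds_L3 (d ℓ) (hℓ : 1 ≤ ℓ) (hodd : Odd (ℓ+1))`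
(the flat (1.59) at `U₀ = 1` on the cube member by the torus transplant, odd `L ≥ 3`).  THIS FILE composes them BY NAME:
* §1 ★★ `gaugedBoundB8_cubeMember_oddL` — for `2 ≤ d`, odd `L ≥ 3`, `5 ≤ d·L`: `∃ B₀ c₁ ρ₀ M₀ N₀ R₀, 1 ≤ B₀ ∧ 0 < c₁ ∧ ∀ η > 0, ∀ {K Ω} (c : CubeB8 d L K Ω)` [print's p.98 side
  conditions on the cube datum: `3 ≤ L^s`, `M₀ ≤ L^{s+1}`, `L^{s+1} ∣ c.ρ`, `L^{s+1} ∣ c.M`, `R·L^{s+1} ≤ c.ρ`, `2L ≤ R`, `R₀ ≤ R`, `N₀ + 1 ≤ R·L^{s+1}`, `ρ₀ ≤ c.ρ`] `∀ U₀` unitary,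
  `∀ α₀ > 0, InAk L K η α₀ Ω U₀ → 7dL²·c.M·α₀ ≤ c₁ → GaugedBoundB8 L η U₀ c (7dL²·(5dLB₀)·c.M·α₀)` — the crown for ALL odd `L ≥ 3` (the `…Holds` file states `5 ≤ L`).
* §2 ★★ `gaugedBoundB8_member_univ` — the H-LANE MEMBER FORM: ambient domains `Ω := fun _ => univ` (J3's (1.34)-𝔄 row `InAk L k η ε₀ univ U′` for the member field
  `U′ := pull (U^{gJ})♯ 0` is EXACTLY the crown's `InAk` input), ambient top level `:= k`, cube datum `c := ⟨k, a, M′, ρ′, _⟩` (our `cubeFam false L a M′ ρ′ k` IS `c.sq`,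
  `cubeLamS L a M′ ρ′ k k` IS `c.lamS` — definitional), under `CubeB8`'s four scalar laws `1 ≤ k`, `L ≤ ρ′ ≤ M′`, `11d < M′`, `L ≤ d·M′` DISPLAYED (its two set laws «□ ⊂ Ω_k», «□̃ ⊂ Ω_{k−1}» are trivial at `Ω := univ`) (obstacle (O2) of the LOCATE: the
  door's prefix fixes `M′` before `ρ`; LOCATE-3: an `M′(ρ)` affine in `ρ` is absorbed by the door's polynomial envelope, or a covering lemma supplies an admissible datum).
CONCLUSION LETTERS (lit ✓`Node00/CarriersB8Cube` :142, all `abbrev`s unfold by `rfl`): `GaugedBoundB8 L η U′ c r` = ∃ `u` unitary, `u = 1` off `c.sq 0 = □₀`, `Restr129 L k c.lamS 1 u`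
((1.29)), `IsLandau138W L k η □₀ c.lamS 1 (c.fixed U′ u)` ((1.38) at background `1`, `c.fixed U′ u = (cutFixed …)^{u⁻¹}`), on every `SideTouches (c.sq j)` bond the exponential form
with `logCfg η (c.fixed U′ u)` Hermitian and `‖·‖ ≤ r(Lʲη)⁻¹` ((1.136)₁ = (1.62)), `(c.vfix U′)⁻¹·u` unitary, `AgreeOn` the top tower box `U′^{((c.vfix U′)⁻¹u)⁻¹} = c.fixed U′ u`,
`msup₋₂ (∇ (c.expo η U′ u)) ≤ r`, `|∂*∂·|₍₋₃₎ ≤ r`, `|Δ·|₍₋₃₎ ≤ r` ((1.136)₂–₄), and the (1.137) identity on the top block.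
USE ((J2) ★w3-19200 g9 `siteRows_of_gaugedBoundB8`): `obtain ⟨B₀, c₁, ρ₀, M₀, N₀, R₀, hB₀, hc₁, hGB⟩ := gaugedBoundB8_member_univ hd2 hL3 hodd hdL` once per `L`, then per member
`obtain ⟨u, hu, huS, h129, h138, h162, hw, h135, hgrad, hJ, hLap, h137⟩ := hGB η hη a hk1 hLρ hρM hbig hLdM s R … U′ hU′ ε₀ hε₀ hInAk hwin`.
OBSTACLE (O1) (SU(2)): `u ∈ unitaryUnits` only; the G-valued crown is asked of pub-ymgap (LEAD-H INBOX 23:30Z; their ✓`B8Thm4SupportLocalBdryG` p678402 is the Theorem-4 layer).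
HONEST SCOPE.  By-name composition of two landed lit theorems; nothing of Prop. 6 is re-proved; the p.98 side conditions and `CubeB8`'s laws stay HYPOTHESES; nothing of the stub,
the crux, the rung or the gap.

References: T. Bałaban, CMP **99** (1985) 75–102 [Balaban1985RegularSpaces] (Prop. 6 (1.135)–(1.138) p.99, p.98 (the cube datum), (1.131) p.99, (1.29) p.81, (1.38) p.82, (1.62) p.87);
CMP **99** (1985) 389–434 [Balaban1985BackgroundPropagators] (Thms 3.1–3.3 pp.397–399 — discharged inside lit's crown at the flat gauge-fixing background).
-/

set_option autoImplicit false

noncomputable section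

open NormedSpace

namespace Summit.QuantumFields.YangMills.Theorems.HalvingP6JGaugedBoundAtMember

open Literature.MathematicalPhysics.QuantumFieldTheory.Balaban1983to89
open B7Prop1Explicit B7Prop2Explicit B7Prop1Local
open B8Ineq132 (InAk)
open B8Ineq159FlatCubeMemberPrinted (Ineq159FlatCubeMemberPrinted)
open B8Ineq159FlatCubeMemberTransplantL3 (ineq159FlatCubeMemberPrinted_holds_L3)
open B8Prop6CubeMemberScalarGammaOfIneq159Printed (gaugedBoundB8_cubeMember_scalar_γ_of_ineq159Printed)
open Node00 (CubeB8 GaugedBoundB8)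

variable {d : ℕ} {𝔸 : Type} [CStarAlgebra 𝔸] [Nontrivial 𝔸]

/-! ## §1 The crown for every odd `L ≥ 3` -/

/-- ★★ **[B8] PROPOSITION 6 AT EVERY PURE CUBE MEMBER, ODD `L ≥ 3`, `2 ≤ d`, `5 ≤ d·L` — UNCONDITIONAL** (lit's γ crown `…_of_ineq159Printed` fed the `L ≥ 3` torus
transplant `ineq159FlatCubeMemberPrinted_holds_L3`). [cite: Balaban1985RegularSpaces, Prop. 6 (1.135)–(1.138) p.99, p.98, (1.131) p.99; Balaban1985BackgroundPropagators, Thm 3.3 p.399] -/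
theorem gaugedBoundB8_cubeMember_oddL (hd2 : 2 ≤ d) {L : ℕ} (hL3 : 3 ≤ L) (hodd : Odd L) (hdL : 5 ≤ d * L) :
    ∃ B₀ c₁ ρ₀ M₀ : ℝ, ∃ N₀ R₀ : ℕ, 1 ≤ B₀ ∧ 0 < c₁ ∧ ∀ (η : ℝ), 0 < η → ∀ {K : ℕ} {Ω : ℕ → Set (Site d)} (c : CubeB8 d L K Ω),
      ∀ (s R : ℕ), 3 ≤ L ^ s → M₀ ≤ (L : ℝ) ^ (s + 1) → L ^ (s + 1) ∣ c.ρ → L ^ (s + 1) ∣ c.M → R * L ^ (s + 1) ≤ c.ρ → 2 * L ≤ R →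
        R₀ ≤ R → N₀ + 1 ≤ R * L ^ (s + 1) → ρ₀ ≤ (c.ρ : ℝ) →
      ∀ (U₀ : Site d → Fin d → 𝔸ˣ), (∀ x κ, U₀ x κ ∈ unitaryUnits 𝔸) → ∀ (α₀ : ℝ), 0 < α₀ → InAk L K η α₀ Ω U₀ →
      7 * d * (L : ℝ) ^ 2 * c.M * α₀ ≤ c₁ →
      GaugedBoundB8 L η U₀ c (7 * d * (L : ℝ) ^ 2 * (5 * (d : ℝ) * L * B₀) * c.M * α₀) := by
  obtain ⟨d', rfl⟩ : ∃ d', d = d' + 1 := ⟨d - 1, by omega⟩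
  obtain ⟨ℓ, rfl⟩ : ∃ ℓ, L = ℓ + 1 := ⟨L - 1, by omega⟩
  exact gaugedBoundB8_cubeMember_scalar_γ_of_ineq159Printed (𝔸 := 𝔸) hd2 (by omega) hdL
    (ineq159FlatCubeMemberPrinted_holds_L3 d' ℓ (by omega) hodd)

/-! ## §2 The H-lane member form: ambient domains `univ`, cube datum `⟨k, a, M′, ρ′⟩` -/

/-- ★★ **PROPOSITION 6 AT THE H LANE's MEMBER** (ambient `Ω := univ`, top level `k`, datum `(a, M′, ρ′)` under `CubeB8`'s four laws DISPLAYED): for odd `L ≥ 3`, `2 ≤ d`,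
`5 ≤ d·L` there are L-only `B₀ ≥ 1`, `c₁ > 0`, `ρ₀ M₀ N₀ R₀` such that every unitary `U′` with `InAk L k η α₀ univ U′` (J3's (1.34)-𝔄 row) and `7dL²·M′·α₀ ≤ c₁` has Prop. 6's
Landau gauge on the cube member `{cubeFam false L a M′ ρ′ k}` with the number `r = 7dL²·(5dLB₀)·M′·α₀` — under print's p.98 side conditions on `(M′, ρ′)`.
[cite: Balaban1985RegularSpaces, Prop. 6 (1.135)–(1.138) p.99, p.98, (1.34) p.82; Balaban1985BackgroundPropagators, Thm 3.3 p.399] -/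
theorem gaugedBoundB8_member_univ (hd2 : 2 ≤ d) {L : ℕ} (hL3 : 3 ≤ L) (hodd : Odd L) (hdL : 5 ≤ d * L) :
    ∃ B₀ c₁ ρ₀ M₀ : ℝ, ∃ N₀ R₀ : ℕ, 1 ≤ B₀ ∧ 0 < c₁ ∧ ∀ (η : ℝ), 0 < η →
      ∀ (a : Site d) {k M' ρ' : ℕ} (hk : 1 ≤ k) (hLρ : L ≤ ρ') (hρM : ρ' ≤ M') (hbig : 11 * d < M') (hLdM : L ≤ d * M'),
      ∀ (s R : ℕ), 3 ≤ L ^ s → M₀ ≤ (L : ℝ) ^ (s + 1) → L ^ (s + 1) ∣ ρ' → L ^ (s + 1) ∣ M' → R * L ^ (s + 1) ≤ ρ' → 2 * L ≤ R →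
        R₀ ≤ R → N₀ + 1 ≤ R * L ^ (s + 1) → ρ₀ ≤ (ρ' : ℝ) →
      ∀ (U' : Site d → Fin d → 𝔸ˣ), (∀ x κ, U' x κ ∈ unitaryUnits 𝔸) → ∀ (α₀ : ℝ), 0 < α₀ →
        InAk L k η α₀ (fun _ => (Set.univ : Set (Site d))) U' →
        7 * d * (L : ℝ) ^ 2 * M' * α₀ ≤ c₁ →
        GaugedBoundB8 L η U'
          ({ k := k, a := a, M := M', ρ := ρ', one_le_k := hk, k_le := le_rfl, L_le_ρ := hLρ, ρ_le_M := hρM, big := hbig, L_le_dM := hLdM,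
             box_sub := Set.subset_univ _, tcube_sub := Set.subset_univ _ } :
            CubeB8 d L k (fun _ => (Set.univ : Set (Site d))))
          (7 * d * (L : ℝ) ^ 2 * (5 * (d : ℝ) * L * B₀) * M' * α₀) := by
  obtain ⟨B₀, c₁, ρ₀, M₀, N₀, R₀, hB₀, hc₁, h⟩ := gaugedBoundB8_cubeMember_oddL (𝔸 := 𝔸) hd2 hL3 hodd hdL
  refine ⟨B₀, c₁, ρ₀, M₀, N₀, R₀, hB₀, hc₁, ?_⟩
  intro η hη a k M' ρ' hk hLρ hρM hbig hLdM s R h3 hM₀ hdρ hdM hRρ h2R hR₀ hN₀ hρ₀ U' hU' α₀ hα₀ hInAk hwin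
  exact h η hη
    ({ k := k, a := a, M := M', ρ := ρ', one_le_k := hk, k_le := le_rfl, L_le_ρ := hLρ, ρ_le_M := hρM, big := hbig, L_le_dM := hLdM,
             box_sub := Set.subset_univ _, tcube_sub := Set.subset_univ _ } :
      CubeB8 d L k (fun _ => (Set.univ : Set (Site d))))
    s R h3 hM₀ hdρ hdM hRρ h2R hR₀ hN₀ hρ₀ U' hU' α₀ hα₀ hInAk hwin

end Summit.QuantumFields.YangMills.Theorems.HalvingP6JGaugedBoundAtMember

end
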